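import Summits.CriticalPhenomena.PercolationContinuityZ3.Theorems.Transplant.FKConjectureCDefs
import Mathlib.Combinatorics.Matroid.Sum
import Mathlib.Data.Finset.Sum
import HarnessLib

/-!
# `(ID)_J` IS CLOSED UNDER DIRECT SUMS: if every level kernel of `M` and of `N` lies in the pair-square cone, so does every level kernel of
# `M ⊕ N` (the critic's lemma in kernel form — fk-crit-1 g3; structure theory of `𝒯 = {M : (ID)_J ∀ J}` for the C″ programme)

Claimed R42 (8)(c) in the cell INBOX at 2026-08-29T10:12:46Z by fkp-10a gen 359 (NEW CLAIM #9 of the gen: director-frontier g16′s slot (d) «ACCEPT THE OFFER», cell INBOX l.8868; Lean text by fk-crit-1 g3), addressed to coordinator fk-4 gen 295 (seated 09:43Z 2026-08-29 by l.8862; R179 l.8865 in force; ruling R180 requested); lineage row FO-10a-g359ds (self-suggested), package g359-directsum, label DS-A.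
Helper file of the `fk-continuity` build cell (bschramm lane; `--supports stmt-CriticalPhenomena-4575 --as helper`), filed by the lane's ledger
writer on director-frontier g16's word (cell INBOX l.8868: «ACCEPT THE OFFER — fkp-10a files the critic's direct-sum closure … ONE file, D-0064,
docstring crediting fk-crit-1 g3»).  MATHEMATICS AND LEAN TEXT BY THE CRITIC fk-crit-1 g3 (refuter-prim-bschramm-fk-crit-1-g3-0): this is
`ideation/prim-bschramm-fk-crit-1/gen3/lean/FKDirectSumSketch.lean` (sha256 55299b1f9668…, `lean check` rc 0 / 0 warnings / 0 sorries, axioms standard)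
with docstrings completed and this header; no statement changed.  builds on p205010 (kernel theorem, internal audit signed; external expert review
pending).  NO definitions (v2: the bookkeeping `pairEquiv` of v1 was Mathlib's `Finset.sumEquiv` — reviewer q13971984, used directly); no named
facts, no sorries, no instances declared, no notation; standard axioms.  NOTHING percolation-bearing follows from this file.

For matroids `M` on `α` and `N` on `β` (finite types) and the direct sum `M.sum N : Matroid (α ⊕ β)` (Mathlib `Matroid.sum`), the doubly odd
nullity-level kernel of `FKConjectureCDefs` splits SLICE-WISE into lower-or-equal-level kernels of the summands:

  `conjCKernel (M.sum N) J x y = [tw_N(x₂,y₂) ≤ J] · conjCKernel M (J − tw_N(x₂,y₂)) x₁ y₁ + [al_M(x₁,y₁) ≤ J] · conjCKernel N (J − al_M(x₁,y₁)) x₂ y₂`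

(`x₁ = x.toLeft`, `x₂ = x.toRight`; nullities are additive over the summands, `corank_sum`; the cross terms `∓1{al_M + tw_N ≤ J}` cancel,
`level_split` / `conjCKernel_sum`), and an elementary square of a slice is an elementary square of the pair space of `α ⊕ β`
(`inPairSquareCone_sliceLeft` / `inPairSquareCone_sliceRight`).  Hence (**`inPairSquareCone_conjCKernel_sum`**): if `conjCKernel M J' ∈ Sq` and
`conjCKernel N J' ∈ Sq` for EVERY level `J'`, then `conjCKernel (M.sum N) J ∈ Sq` for every `J` — `𝒯` IS CLOSED UNDER DIRECT SUMS.  Consequences for the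
books (not typed here): loops / coloops / direct summands never matter for membership in `𝒯`; `FK.ConjectureCGraphic` (`Transplant/FKConjectureCGraphic`,
p710750) reduces to 2-connected graphs.  2-SUMS ARE NOT COVERED AND DO FAIL IN GENERAL: `S₈ ∈ 𝒯` (exact certificates, all levels) while
`S₈⁺ = (S₈ ⊕₂ U_{1,3}) ⊕₂ U_{1,3} ∉ (ID)_0` (`FKConjectureC/Negative/S8ParCounterexample`, p711419).
HONESTY: FBP₀ frontier rung; a closure lemma about the lane's own kernel; nothing percolation-bearing; typed ≠ proved until the gate accepts.

Instance bookkeeping: the defs file elaborates `x \ y`, `insert a x`, `xᶜ` on a generic ground type with the scoped classical instance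
`fun a b => Classical.propDecidable (a = b)`; to make the statements on `α ⊕ β` match that instantiation syntactically the structural instance
`instDecidableEqSum` is switched off locally in this file (`attribute [-instance]`; all `Decidable` instances are subsingletons — bookkeeping only,
no mathematical content; the same device as `S8ParCex.decEq_classical_eq`).

## References

* J. Oxley, *Matroid Theory*, 2nd ed., OUP (2011), §4.2 (direct sums), §1.3 (nullity). [Oxley2011]
* D. G. Wagner, *Negatively correlated random variables and Mason's conjecture*, arXiv:math/0602648 (2006), Thm. 5.8(d), §5.3. [Wagner2006]
-/

namespace Summit.CriticalPhenomena.PercolationContinuityZ3.Theorems.FK.DirectSum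

open Literature.Combinatorics.Matroid Finset
open scoped Classical

attribute [-instance] instDecidableEqSum

variable {α β : Type*}

/-! ### Rank and corank of `Matroid.sum` are additive -/

/-- The rank function of `M.sum N` is the sum of the rank functions of the summands on the two preimages. [folklore] -/
theorem eRk_sum (M : Matroid α) (N : Matroid β) (X : Set (α ⊕ β)) :
    (M.sum N).eRk X = M.eRk (Sum.inl ⁻¹' X) + N.eRk (Sum.inr ⁻¹' X) := by
  set X' : Set (α ⊕ β) := X ∩ (M.sum N).E with hX'
  obtain ⟨I, hI⟩ := (M.sum N).exists_isBasis X' Set.inter_subset_right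
  have hb := Matroid.sum_isBasis_iff.mp hI
  have hIeq : I = Sum.inl '' (Sum.inl ⁻¹' I) ∪ Sum.inr '' (Sum.inr ⁻¹' I) := by
    ext z; rcases z with a | b <;> simp
  have hdisj : Disjoint (Sum.inl '' (Sum.inl ⁻¹' I) : Set (α ⊕ β)) (Sum.inr '' (Sum.inr ⁻¹' I)) := by
    rw [Set.disjoint_left]
    rintro _ ⟨a, _, rfl⟩ ⟨b, _, h⟩
    exact Sum.inr_ne_inl h
  have hcard : I.encard = (Sum.inl ⁻¹' I).encard + (Sum.inr ⁻¹' I).encard := by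
    conv_lhs => rw [hIeq]
    rw [Set.encard_union_eq hdisj, Sum.inl_injective.encard_image, Sum.inr_injective.encard_image]
  have h1 : Sum.inl ⁻¹' X' = Sum.inl ⁻¹' X ∩ M.E := by
    ext a; simp [hX', Matroid.sum_ground]
  have h2 : Sum.inr ⁻¹' X' = Sum.inr ⁻¹' X ∩ N.E := by
    ext b; simp [hX', Matroid.sum_ground]
  rw [← Matroid.eRk_inter_ground (M := M.sum N) (X := X), ← hI.encard_eq_eRk, hcard, hb.1.encard_eq_eRk,
    hb.2.encard_eq_eRk, h1, h2, Matroid.eRk_inter_ground, Matroid.eRk_inter_ground]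

/-- The left part of a finset of `α ⊕ β`, as a set, is the preimage under `Sum.inl`. [folklore] -/
theorem coe_toLeft (u : Finset (α ⊕ β)) : ((u.toLeft : Finset α) : Set α) = Sum.inl ⁻¹' (u : Set (α ⊕ β)) := by
  ext a; simp

/-- The right part of a finset of `α ⊕ β`, as a set, is the preimage under `Sum.inr`. [folklore] -/
theorem coe_toRight (u : Finset (α ⊕ β)) : ((u.toRight : Finset β) : Set β) = Sum.inr ⁻¹' (u : Set (α ⊕ β)) := by
  ext b; simp

/-- The rank of a finite set is finite. [cite: Oxley2011, §1.3] -/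
theorem eRk_coe_ne_top {γ : Type*} (M : Matroid γ) (s : Finset γ) : M.eRk (s : Set γ) ≠ ⊤ :=
  ne_top_of_le_ne_top (ENat.coe_ne_top s.card)
    (by rw [← Set.encard_coe_eq_coe_finsetCard]; exact M.eRk_le_encard _)

/-- **Corank is additive over a direct sum**: `ℓ_{M ⊕ N}(u) = ℓ_M(u₁) + ℓ_N(u₂)`. [folklore] -/
theorem corank_sum (M : Matroid α) (N : Matroid β) (u : Finset (α ⊕ β)) :
    corank (M.sum N) u = corank M u.toLeft + corank N u.toRight := by
  have h := eRk_sum M N (u : Set (α ⊕ β))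
  rw [← coe_toLeft, ← coe_toRight] at h
  have h' : ((M.sum N).eRk (u : Set (α ⊕ β))).toNat =
      (M.eRk (u.toLeft : Set α)).toNat + (N.eRk (u.toRight : Set β)).toNat := by
    rw [h, ENat.toNat_add (eRk_coe_ne_top _ _) (eRk_coe_ne_top _ _)]
  have e1 := eRk_toNat_add_corank (M.sum N) u
  have e2 := eRk_toNat_add_corank M u.toLeft
  have e3 := eRk_toNat_add_corank N u.toRight
  have hc := card_toLeft_add_card_toRight (u := u)
  omega

/-! ### The two nullity levels split -/

/-- `toLeft` commutes with set difference. [folklore] -/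
theorem toLeft_sdiff' (u v : Finset (α ⊕ β)) : (u \ v).toLeft = u.toLeft \ v.toLeft := by
  ext a; simp

/-- `toRight` commutes with set difference. [folklore] -/
theorem toRight_sdiff' (u v : Finset (α ⊕ β)) : (u \ v).toRight = u.toRight \ v.toRight := by
  ext b; simp

/-- `toLeft` commutes with intersection. [folklore] -/
theorem toLeft_inter' (u v : Finset (α ⊕ β)) : (u ∩ v).toLeft = u.toLeft ∩ v.toLeft := by
  ext a; simp

/-- `toRight` commutes with intersection. [folklore] -/
theorem toRight_inter' (u v : Finset (α ⊕ β)) : (u ∩ v).toRight = u.toRight ∩ v.toRight := by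
  ext b; simp

/-- **The twisted nullity level is additive over a direct sum**: `tw_{M⊕N}(x,y) = tw_M(x₁,y₁) + tw_N(x₂,y₂)`. [cite: Oxley2011, §4.2] -/
theorem twistedNullLevel_sum (M : Matroid α) (N : Matroid β) (x y : Finset (α ⊕ β)) :
    twistedNullLevel (M.sum N) x y =
      twistedNullLevel M x.toLeft y.toLeft + twistedNullLevel N x.toRight y.toRight := by
  simp only [twistedNullLevel, corank_sum, toLeft_sdiff', toRight_sdiff']
  ring

variable [Fintype α] [Fintype β]

/-- `toLeft` commutes with complement. [folklore] -/
theorem toLeft_compl (u : Finset (α ⊕ β)) : uᶜ.toLeft = u.toLeftᶜ := by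
  ext a; simp

/-- `toRight` commutes with complement. [folklore] -/
theorem toRight_compl (u : Finset (α ⊕ β)) : uᶜ.toRight = u.toRightᶜ := by
  ext b; simp

/-- **The aligned nullity level is additive over a direct sum**: `al_{M⊕N}(x,y) = al_M(x₁,y₁) + al_N(x₂,y₂)`. [cite: Oxley2011, §4.2] -/
theorem alignedNullLevel_sum (M : Matroid α) (N : Matroid β) (x y : Finset (α ⊕ β)) :
    alignedNullLevel (M.sum N) x y =
      alignedNullLevel M x.toLeft y.toLeft + alignedNullLevel N x.toRight y.toRight := by
  simp only [alignedNullLevel, corank_sum, toLeft_inter', toRight_inter', toLeft_compl, toRight_compl]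
  ring

/-! ### The slice identity for the kernel -/

/-- Bookkeeping of the four indicators (`t₁ + t₂ ≤ J`, `a₁ + a₂ ≤ J` against the sliced levels). [folklore] -/
theorem level_split (t₁ t₂ a₁ a₂ J : ℕ) :
    ((if t₁ + t₂ ≤ J then (1 : ℝ) else 0) - (if a₁ + a₂ ≤ J then 1 else 0)) =
      (if t₂ ≤ J then ((if t₁ ≤ J - t₂ then (1 : ℝ) else 0) - (if a₁ ≤ J - t₂ then 1 else 0)) else 0) +
      (if a₁ ≤ J then ((if t₂ ≤ J - a₁ then (1 : ℝ) else 0) - (if a₂ ≤ J - a₁ then 1 else 0)) else 0) := by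
  split_ifs <;> first | (exfalso; omega) | norm_num

/-- **Slice identity**: `K_J(M ⊕ N)(x,y) = [tw_N ≤ J]·K_{J−tw_N}(M)(x₁,y₁) + [al_M ≤ J]·K_{J−al_M}(N)(x₂,y₂)`. [folklore] -/
theorem conjCKernel_sum (M : Matroid α) (N : Matroid β) (J : ℕ) (x y : Finset (α ⊕ β)) :
    conjCKernel (M.sum N) J x y =
      (if twistedNullLevel N x.toRight y.toRight ≤ J then
          conjCKernel M (J - twistedNullLevel N x.toRight y.toRight) x.toLeft y.toLeft else 0) +
      (if alignedNullLevel M x.toLeft y.toLeft ≤ J then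
          conjCKernel N (J - alignedNullLevel M x.toLeft y.toLeft) x.toRight y.toRight else 0) := by
  simp only [conjCKernel, twistedNullLevel_sum, alignedNullLevel_sum]
  exact level_split _ _ _ _ _

/-! ### Cone bookkeeping: sums, zero, slices -/

/-- The square cone is closed under addition (add the certificates). [cite: Wagner2006, Thm. 5.8(d), §5.3] -/
theorem inPairSquareCone_add' {γ : Type*} [Fintype γ] {K L : Finset γ → Finset γ → ℝ}
    (hK : InPairSquareCone K) (hL : InPairSquareCone L) : InPairSquareCone (fun x y => K x y + L x y) := by
  obtain ⟨c, hc, hK⟩ := hK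
  obtain ⟨d, hd, hL⟩ := hL
  refine ⟨fun x y a b => c x y a b + d x y a b, fun _ _ _ _ => add_nonneg (hc _ _ _ _) (hd _ _ _ _), fun Φ => ?_⟩
  simp only [add_mul, Finset.sum_add_distrib]
  rw [hK Φ, hL Φ]

/-- The zero kernel is in the square cone (zero certificate). [cite: Wagner2006, Thm. 5.8(d), §5.3] -/
theorem inPairSquareCone_zero' {γ : Type*} [Fintype γ] : InPairSquareCone (fun _ _ : Finset γ => (0 : ℝ)) :=
  ⟨fun _ _ _ _ => 0, fun _ _ _ _ => le_rfl, fun Φ => by simp⟩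

/-- A guarded family of cone members is a cone member (the guard is decided outside). [folklore] -/
theorem inPairSquareCone_ite {γ : Type*} [Fintype γ] (P : Prop) [Decidable P] {K : Finset γ → Finset γ → ℝ}
    (hK : InPairSquareCone K) : InPairSquareCone (fun x y => if P then K x y else 0) := by
  by_cases hP : P
  · simp only [hP, if_true]; exact hK
  · simp only [hP, if_false]; exact inPairSquareCone_zero'

/-- Summing over `Finset (α ⊕ β)` = summing over pairs `(s,t)` via `s.disjSum t` (product order, left outer). [folklore] -/
theorem sum_eq_sum_disjSum (f : Finset (α ⊕ β) → ℝ) :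
    ∑ u : Finset (α ⊕ β), f u = ∑ t : Finset β, ∑ s : Finset α, f (s.disjSum t) := by
  rw [← Equiv.sum_comp (Finset.sumEquiv (α := α) (β := β)).toEquiv.symm, Fintype.sum_prod_type_right]
  rfl

/-- Summing over `Finset (α ⊕ β)` = summing over pairs `(s,t)` via `s.disjSum t` (product order, right outer). [folklore] -/
theorem sum_eq_sum_disjSum' (f : Finset (α ⊕ β) → ℝ) :
    ∑ u : Finset (α ⊕ β), f u = ∑ s : Finset α, ∑ t : Finset β, f (s.disjSum t) := by
  rw [← Equiv.sum_comp (Finset.sumEquiv (α := α) (β := β)).toEquiv.symm, Fintype.sum_prod_type]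
  rfl

omit [Fintype α] [Fintype β] in
/-- `insert (inl a) (s.disjSum t) = (insert a s).disjSum t`. [folklore] -/
theorem insert_inl_disjSum (a : α) (s : Finset α) (t : Finset β) :
    insert (Sum.inl a) (s.disjSum t) = (insert a s).disjSum t := by
  ext z; rcases z with z | z <;> simp

omit [Fintype α] [Fintype β] in
/-- `insert (inr b) (s.disjSum t) = s.disjSum (insert b t)`. [folklore] -/
theorem insert_inr_disjSum (b : β) (s : Finset α) (t : Finset β) :
    insert (Sum.inr b) (s.disjSum t) = s.disjSum (insert b t) := by
  ext z; rcases z with z | z <;> simp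

/-- **Left slices**: if for every fixed right pair `(x₂,y₂)` the `α`-kernel `F(·,·,x₂,y₂)` is in the square cone of `α`, then the assembled kernel on
`α ⊕ β` is in the square cone of `α ⊕ β` (each elementary square `(x₁, x₁+a) × (y₁, y₁+b)` of the slice is the elementary square
`(x, x + inl a) × (y, y + inl b)`). [folklore] -/
theorem inPairSquareCone_sliceLeft (F : Finset α → Finset α → Finset β → Finset β → ℝ)
    (h : ∀ x₂ y₂ : Finset β, InPairSquareCone (fun x₁ y₁ => F x₁ y₁ x₂ y₂)) :
    InPairSquareCone (fun x y : Finset (α ⊕ β) => F x.toLeft y.toLeft x.toRight y.toRight) := by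
  choose c hc hcert using h
  refine ⟨fun x y p q => Sum.elim (fun a => Sum.elim (fun b => c x.toRight y.toRight x.toLeft y.toLeft a b) (fun _ => 0) q)
      (fun _ => 0) p, ?_, fun Φ => ?_⟩
  · intro x y p q
    rcases p with a | a <;> rcases q with b | b <;> simp [hc]
  · -- right-hand side: only the `inl/inl` squares carry weight
    have hR : ∀ x y : Finset (α ⊕ β),
        ∑ p : α ⊕ β, ∑ q : α ⊕ β,
          Sum.elim (fun a => Sum.elim (fun b => c x.toRight y.toRight x.toLeft y.toLeft a b) (fun _ => 0) q)
              (fun _ => 0) p *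
            (Φ x y + Φ (insert p x) (insert q y) - Φ (insert p x) y - Φ x (insert q y)) =
        ∑ a : α, ∑ b : α, c x.toRight y.toRight x.toLeft y.toLeft a b *
            (Φ x y + Φ (insert (Sum.inl a) x) (insert (Sum.inl b) y) - Φ (insert (Sum.inl a) x) y
              - Φ x (insert (Sum.inl b) y)) := by
      intro x y
      simp only [Fintype.sum_sum_type, Sum.elim_inl, Sum.elim_inr, zero_mul, Finset.sum_const_zero, add_zero]
    simp_rw [hR]
    -- reindex both sides over `(x₁, x₂)` and `(y₁, y₂)`
    rw [sum_eq_sum_disjSum, sum_eq_sum_disjSum]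
    simp_rw [sum_eq_sum_disjSum (fun y => F _ (Finset.toLeft y) _ (Finset.toRight y) * Φ _ y)]
    simp_rw [sum_eq_sum_disjSum (fun y => ∑ a : α, ∑ b : α, c (Finset.toRight _) (Finset.toRight y) (Finset.toLeft _)
      (Finset.toLeft y) a b * (Φ _ y + Φ _ (insert (Sum.inl b) y) - Φ _ y - Φ _ (insert (Sum.inl b) y)))]
    simp only [toLeft_disjSum, toRight_disjSum, insert_inl_disjSum]
    -- now: ∑ x₂ ∑ x₁ ∑ y₂ ∑ y₁ (...)  on both sides; bring `y₂` next to `x₂` and use the slice certificates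
    refine Finset.sum_congr rfl fun x₂ _ => ?_
    rw [Finset.sum_comm]
    conv_rhs => rw [Finset.sum_comm]
    refine Finset.sum_congr rfl fun y₂ _ => ?_
    exact hcert x₂ y₂ (fun x₁ y₁ => Φ (x₁.disjSum x₂) (y₁.disjSum y₂))

/-- **Right slices** (mirror image of `inPairSquareCone_sliceLeft`). [folklore] -/
theorem inPairSquareCone_sliceRight (F : Finset α → Finset α → Finset β → Finset β → ℝ)
    (h : ∀ x₁ y₁ : Finset α, InPairSquareCone (fun x₂ y₂ => F x₁ y₁ x₂ y₂)) :
    InPairSquareCone (fun x y : Finset (α ⊕ β) => F x.toLeft y.toLeft x.toRight y.toRight) := by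
  choose c hc hcert using h
  refine ⟨fun x y p q => Sum.elim (fun _ => 0)
      (fun a => Sum.elim (fun _ => 0) (fun b => c x.toLeft y.toLeft x.toRight y.toRight a b) q) p, ?_, fun Φ => ?_⟩
  · intro x y p q
    rcases p with a | a <;> rcases q with b | b <;> simp [hc]
  · have hR : ∀ x y : Finset (α ⊕ β),
        ∑ p : α ⊕ β, ∑ q : α ⊕ β,
          Sum.elim (fun _ => 0)
              (fun a => Sum.elim (fun _ => 0) (fun b => c x.toLeft y.toLeft x.toRight y.toRight a b) q) p *
            (Φ x y + Φ (insert p x) (insert q y) - Φ (insert p x) y - Φ x (insert q y)) =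
        ∑ a : β, ∑ b : β, c x.toLeft y.toLeft x.toRight y.toRight a b *
            (Φ x y + Φ (insert (Sum.inr a) x) (insert (Sum.inr b) y) - Φ (insert (Sum.inr a) x) y
              - Φ x (insert (Sum.inr b) y)) := by
      intro x y
      simp only [Fintype.sum_sum_type, Sum.elim_inl, Sum.elim_inr, zero_mul, Finset.sum_const_zero, zero_add]
    simp_rw [hR]
    rw [sum_eq_sum_disjSum', sum_eq_sum_disjSum']
    simp_rw [sum_eq_sum_disjSum' (fun y => F _ (Finset.toLeft y) _ (Finset.toRight y) * Φ _ y)]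
    simp_rw [sum_eq_sum_disjSum' (fun y => ∑ a : β, ∑ b : β, c (Finset.toLeft _) (Finset.toLeft y) (Finset.toRight _)
      (Finset.toRight y) a b * (Φ _ y + Φ _ (insert (Sum.inr b) y) - Φ _ y - Φ _ (insert (Sum.inr b) y)))]
    simp only [toLeft_disjSum, toRight_disjSum, insert_inr_disjSum]
    -- now: ∑ x₁ ∑ x₂ ∑ y₁ ∑ y₂ (...) on both sides; bring `y₁` next to `x₁` and use the slice certificates
    refine Finset.sum_congr rfl fun x₁ _ => ?_
    rw [Finset.sum_comm]
    conv_rhs => rw [Finset.sum_comm]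
    refine Finset.sum_congr rfl fun y₁ _ => ?_
    exact hcert x₁ y₁ (fun x₂ y₂ => Φ (x₁.disjSum x₂) (y₁.disjSum y₂))

/-! ### The theorem -/

/-- **`𝒯` is closed under direct sums**: if every level of `M` and every level of `N` is in the square cone, so is every level of `M ⊕ N`.
[folklore] -/
theorem inPairSquareCone_conjCKernel_sum (M : Matroid α) (N : Matroid β)
    (hM : ∀ J, InPairSquareCone (conjCKernel M J)) (hN : ∀ J, InPairSquareCone (conjCKernel N J)) (J : ℕ) :
    InPairSquareCone (conjCKernel (M.sum N) J) := by
  have h1 : InPairSquareCone (fun x y : Finset (α ⊕ β) =>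
      (if twistedNullLevel N x.toRight y.toRight ≤ J then
          conjCKernel M (J - twistedNullLevel N x.toRight y.toRight) x.toLeft y.toLeft else 0)) :=
    inPairSquareCone_sliceLeft
      (fun x₁ y₁ x₂ y₂ => if twistedNullLevel N x₂ y₂ ≤ J then conjCKernel M (J - twistedNullLevel N x₂ y₂) x₁ y₁ else 0)
      (fun x₂ y₂ => inPairSquareCone_ite _ (hM _))
  have h2 : InPairSquareCone (fun x y : Finset (α ⊕ β) =>
      (if alignedNullLevel M x.toLeft y.toLeft ≤ J then
          conjCKernel N (J - alignedNullLevel M x.toLeft y.toLeft) x.toRight y.toRight else 0)) :=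
    inPairSquareCone_sliceRight
      (fun x₁ y₁ x₂ y₂ => if alignedNullLevel M x₁ y₁ ≤ J then conjCKernel N (J - alignedNullLevel M x₁ y₁) x₂ y₂ else 0)
      (fun x₁ y₁ => inPairSquareCone_ite _ (hN _))
  have h := inPairSquareCone_add' h1 h2
  have hfun : (fun x y : Finset (α ⊕ β) =>
      (if twistedNullLevel N x.toRight y.toRight ≤ J then
          conjCKernel M (J - twistedNullLevel N x.toRight y.toRight) x.toLeft y.toLeft else 0) +
      (if alignedNullLevel M x.toLeft y.toLeft ≤ J then
          conjCKernel N (J - alignedNullLevel M x.toLeft y.toLeft) x.toRight y.toRight else 0)) =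
      conjCKernel (M.sum N) J := by
    funext x y; rw [conjCKernel_sum]
  rwa [hfun] at h

end Summit.CriticalPhenomena.PercolationContinuityZ3.Theorems.FK.DirectSum
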